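import Literature.Topology.FourManifolds.LatticeFormsSpecialOrthogonalReflectionPairs
import Literature.Topology.FourManifolds.LatticeFormsNegTwoVectorOrbitsOriented
import Literature.Topology.FourManifolds.LatticeFormsStableEquivalence
import HarnessLib

/-!
# `σ_a σ_{g(a)} = [g, σ_a]`: products of two reflections in one orbit are commutators — GHS Prop. 1.6 by its printed
# proof, for every even unimodular lattice with two hyperbolic planes, and Thm. 1.3 with one orbit of roots
# (Gritsenko–Hulek–Sankaran, *J. Algebra* 322 (2009) Thm. 1.3 (proof), Prop. 1.6 (proof); GHS, *Doc. Math.* 13 (2008) Prop. 2.4 (i))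

Trunk T-4MAN vocabulary. Rows g50-#2/#3 proved Prop. 1.6 for `L ≅ U^{⊕n}` (`n ≥ 3`) through the perfectness of the Eichler
words (GHS §4.1). This file formalizes the PRINTED proof of Prop. 1.6 and of Thm. 1.3, which is a different and more general
mechanism: "`σ_aσ_b = σ_aσ_{g(a)} = σ_a g σ_a g⁻¹` is a commutator" as soon as `g(a) = b` for some `g` in the group. Combined
with the one-orbit theorem for `(−2)`-vectors under `O⁺` (GHS 2008 Prop. 2.4 (i), `LatticeFormsNegTwoVectorOrbitsOriented`), it
gives, for EVERY symmetric even unimodular lattice with `n₊, n₋ ≥ 2` (all `II_{p,q}` with two hyperbolic planes — e.g. the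
K3-type period lattices `II_{2,10}`, `II_{2,18}`, `II_{3,19}`, not only signature `0`): every product `σ_aσ_b` of two
`(−2)`-reflections is a word in commutators of `O⁺(L)`, hence a word in the `(−2)`-reflections is a commutator word of
`O⁺(L)` iff its determinant is `1` (Thm. 1.3 with `N = 1` orbit: "`⟨σ_a⟩^{ab}` has order dividing `2`"). Written for lane
`lit-hodgefound` (Track 2 foundations; prover seat `lit-hodgefound-p18`, gen 50, row g50-#9). THEOREMS ONLY — no definition,
no named fact, no instance, no notation.

## Sources, verbatim

* GHS 2009 (held `paper:arxiv-0810.1614`) p. 3, proof of **Theorem 1.3**: "For roots `a, b ∈ L` we write `a ≡ b mod Õ⁺(L)` if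
  there exists `g ∈ Õ⁺(L)` such that `g(a) = b`. In this case `σ_{g(a)} = gσ_ag⁻¹` and `σ_aσ_b ∈ [Õ⁺(L), Õ⁺(L)]`. […] Using
  this, and the evident property `σ_uσ_v = σ_{σ_u(v)}σ_u`, we can rewrite any class modulo commutator […]". Statement: "Then
  `Õ⁺(L)^{ab}` (resp. `S̃O⁺(L)^{ab}`) is an abelian 2-group. Its order divides `2^N` (resp. `2^{N−1}`), where `N` is the number of
  different `Õ⁺(L)`-orbits (resp. `S̃O⁺(L)`-orbits) of `(−2)`-vectors in `L`."
* p. 4, **Proposition 1.6** "Let `L = 2U ⊕ L₁` be an even unimodular lattice of rank at least 6. Then `S̃O⁺(L)^{ab}` is trivial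
  and `Õ⁺(L)^{ab} ≅ ℤ/2ℤ`. *Proof.* […] The orbit of a `(−2)`-vector `a` is determined by its image in the discriminant group
  […]. But that group is trivial. Therefore there exists `g ∈ SO⁺(L)` such that `g(a) = b`. But then
  `σ_aσ_b = σ_aσ_{g(a)} = σ_a g σ_a g⁻¹` is a commutator."
* GHS 2008 Prop. 2.4 (i) (the tree's `exists_isometryEquiv_isOrientationPreserving_apply_eq_of_apply_self_eq_neg_two`): any two
  `(−2)`-vectors of an even unimodular lattice with `n± ≥ 2` are equivalent modulo `O⁺`.

TODO(general form): Thm. 1.3 with `N ≥ 2` orbits (the rewriting by `σ_uσ_v = σ_{σ_u(v)}σ_u` — the identity is proved here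
as `normTwoReflectionEquiv_apply_normTwoReflectionEquiv_apply`), and the Kneser input `O⁺(L) = ⟨σ_a⟩` for general `L`
(the tree has it for `L ≅ U^{⊕n}`, `n ≥ 3`, row g49-#15), which would upgrade §3 to `Õ⁺(L)^{ab} ≅ ℤ/2ℤ` for all such `L`.

## Contents (all proved)

* §1 (any symmetric lattice, either sign `ε = ±1`) the commutator identity `σ_aσ_{g(a)} = [g, σ_a]` pointwise
  (`normTwoReflectionEquiv_trans_normTwoReflectionEquiv_map_apply`) and as a commutator WORD of any class of isometries
  containing `g` and `σ_a`; "`σ_uσ_v = σ_{σ_u(v)}σ_u`"; **Thm. 1.3, one orbit**: if the `(2ε)`-roots form one orbit under a class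
  `P ∋ σ_r` then every product of two `(2ε)`-reflections, and every word of determinant `1` in them, is a word in commutators
  of `P`-isometries, and conversely commutator words have determinant `1`.
* §2 **Prop. 1.6 (printed proof) for every symmetric even unimodular lattice with `n± ≥ 2`**: `σ_aσ_b` (`a² = b² = −2`) is a
  word in commutators of `O⁺(L)`; a word in `(−2)`-reflections is a commutator word of `O⁺(L)` iff `det = 1`.
* §3 the same for `U^{⊕n}`, **`n ≥ 2`** (row g50-#2 needed `n ≥ 3`).
-/

noncomputable section

open Module
open LinearMap (BilinForm)
open LinearMap.BilinForm
open LinearMap.BilinForm (IsometryEquiv)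

namespace Literature.Topology.FourManifolds

universe u

/-! ### §1 The commutator identity and Theorem 1.3 with one orbit (any symmetric lattice, either sign) -/

section Identity

variable {W : Type*} [AddCommGroup W] {B : BilinForm ℤ W}

/-- **`σ_aσ_{g(a)} = σ_a g σ_a g⁻¹` is a commutator** (pointwise form; `σ_{g(a)} = gσ_ag⁻¹`, `σ_a⁻¹ = σ_a`): in the tree's
diagrammatic order, `σ_a.trans σ_{g a}` (the map `v ↦ σ_{g(a)}(σ_a v)`) agrees with the commutator
`[g, σ_a] = ((σ_a⁻¹·g⁻¹)·σ_a)·g` (the map `v ↦ g(σ_a(g⁻¹(σ_a⁻¹ v)))`).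
[cite: GritsenkoHulekSankaran2009, Prop. 1.6 (proof: "σ_aσ_b = σ_aσ_{g(a)} = σ_a g σ_a g⁻¹ is a commutator") and Thm. 1.3 (proof: "σ_{g(a)} = gσ_ag⁻¹")] -/
theorem normTwoReflectionEquiv_trans_normTwoReflectionEquiv_map_apply (hB : B.IsSymm) {a : W} {ε : ℤ} (ha : B a a = ε + ε)
    (hε : ε * ε = 1) (g : B.IsometryEquiv B) (hga : B (g a) (g a) = ε + ε) (v : W) :
    ((normTwoReflectionEquiv hB a ε ha hε).trans (normTwoReflectionEquiv hB (g a) ε hga hε)) v =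
      ((((normTwoReflectionEquiv hB a ε ha hε).symm.trans g.symm).trans (normTwoReflectionEquiv hB a ε ha hε)).trans g) v := by
  rw [LinearMap.BilinForm.IsometryEquiv.trans_apply, ← normTwoReflectionEquiv_conj_apply hB hB g ha hε hga]
  simp only [LinearMap.BilinForm.IsometryEquiv.trans_apply, normTwoReflectionEquiv_symm]

/-- **`σ_aσ_{g(a)}` is a word in commutators `[α, β]` of any class `P` of isometries containing `g` and `σ_a`** (namely the
single commutator `[g, σ_a]`). [cite: GritsenkoHulekSankaran2009, Prop. 1.6 (proof) and Thm. 1.3 (proof: "σ_aσ_b ∈ [Õ⁺(L), Õ⁺(L)]")] -/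
theorem isWordIn_commutators_normTwoReflectionEquiv_trans_map_of {P : B.IsometryEquiv B → Prop} (hB : B.IsSymm) {a : W}
    {ε : ℤ} (ha : B a a = ε + ε) (hε : ε * ε = 1) (g : B.IsometryEquiv B) (hga : B (g a) (g a) = ε + ε) (hg : P g)
    (hσ : P (normTwoReflectionEquiv hB a ε ha hε)) :
    IsWordIn {ψ : B.IsometryEquiv B | ∃ α β : B.IsometryEquiv B, P α ∧ P β ∧ ψ = ((β.symm.trans α.symm).trans β).trans α}
      ((normTwoReflectionEquiv hB a ε ha hε).trans (normTwoReflectionEquiv hB (g a) ε hga hε)) :=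
  (IsWordIn.of_mem (S := {ψ : B.IsometryEquiv B | ∃ α β : B.IsometryEquiv B, P α ∧ P β ∧
      ψ = ((β.symm.trans α.symm).trans β).trans α}) ⟨g, normTwoReflectionEquiv hB a ε ha hε, hg, hσ, rfl⟩).congr fun v ↦
    (normTwoReflectionEquiv_trans_normTwoReflectionEquiv_map_apply hB ha hε g hga v).symm

/-- **`σ_aσ_{g(a)} ∈ [O(L), O(L)]`** as a word (the class of all isometries).
[cite: GritsenkoHulekSankaran2009, Prop. 1.6 (proof) and Thm. 1.3 (proof)] -/
theorem isWordIn_commutators_normTwoReflectionEquiv_trans_map (hB : B.IsSymm) {a : W} {ε : ℤ} (ha : B a a = ε + ε)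
    (hε : ε * ε = 1) (g : B.IsometryEquiv B) (hga : B (g a) (g a) = ε + ε) :
    IsWordIn {ψ : B.IsometryEquiv B | ∃ α β : B.IsometryEquiv B, ψ = ((β.symm.trans α.symm).trans β).trans α}
      ((normTwoReflectionEquiv hB a ε ha hε).trans (normTwoReflectionEquiv hB (g a) ε hga hε)) := by
  refine (isWordIn_commutators_normTwoReflectionEquiv_trans_map_of (P := fun _ ↦ True) hB ha hε g hga trivial trivial).mono
    fun ψ hψ ↦ ?_
  obtain ⟨α, β, -, -, h⟩ := hψ
  exact ⟨α, β, h⟩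

/-- **"The evident property `σ_uσ_v = σ_{σ_u(v)}σ_u`"**: `σ_u(σ_v x) = σ_{σ_u(v)}(σ_u x)` (either signs).
[cite: GritsenkoHulekSankaran2009, Thm. 1.3 (proof)] -/
theorem normTwoReflectionEquiv_apply_normTwoReflectionEquiv_apply (hB : B.IsSymm) {u v : W} {ε₁ ε₂ : ℤ}
    (hu : B u u = ε₁ + ε₁) (hε₁ : ε₁ * ε₁ = 1) (hv : B v v = ε₂ + ε₂) (hε₂ : ε₂ * ε₂ = 1)
    (hv' : B (normTwoReflectionEquiv hB u ε₁ hu hε₁ v) (normTwoReflectionEquiv hB u ε₁ hu hε₁ v) = ε₂ + ε₂) (x : W) :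
    normTwoReflectionEquiv hB u ε₁ hu hε₁ (normTwoReflectionEquiv hB v ε₂ hv hε₂ x) =
      normTwoReflectionEquiv hB (normTwoReflectionEquiv hB u ε₁ hu hε₁ v) ε₂ hv' hε₂ (normTwoReflectionEquiv hB u ε₁ hu hε₁ x) := by
  have h := normTwoReflectionEquiv_conj_apply hB hB (normTwoReflectionEquiv hB u ε₁ hu hε₁) hv hε₂ hv'
    (normTwoReflectionEquiv hB u ε₁ hu hε₁ x)
  rwa [LinearMap.BilinForm.IsometryEquiv.trans_apply, LinearMap.BilinForm.IsometryEquiv.trans_apply,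
    LinearMap.BilinForm.IsometryEquiv.symm_apply_apply] at h

/-- The square of a reflected vector: `(σ_u v)² = v²`. [cite: GritsenkoHulekSankaran2009, Thm. 1.3 (proof)] -/
theorem apply_normTwoReflectionEquiv_apply_self (hB : B.IsSymm) {u : W} {ε : ℤ} (hu : B u u = ε + ε) (hε : ε * ε = 1) (v : W) :
    B (normTwoReflectionEquiv hB u ε hu hε v) (normTwoReflectionEquiv hB u ε hu hε v) = B v v :=
  (normTwoReflectionEquiv hB u ε hu hε).map_app v v

/-- **Theorem 1.3 with ONE orbit, pairs**: if the `(2ε)`-roots of `L` form a single orbit under a class `P` of isometries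
containing the `(2ε)`-reflections ("`a ≡ b mod Õ⁺(L)`" for all roots), then every product `σ_aσ_b` of two `(2ε)`-reflections —
hence every word in such products — is a word in commutators `[α, β]`, `α, β ∈ P`.
[cite: GritsenkoHulekSankaran2009, Thm. 1.3 (proof: "In this case σ_{g(a)} = gσ_ag⁻¹ and σ_aσ_b ∈ [Õ⁺(L), Õ⁺(L)]")] -/
theorem isWordIn_commutators_of_isWordIn_reflectionPairs_of_forall_exists {P : B.IsometryEquiv B → Prop} (hB : B.IsSymm)
    {ε : ℤ} (hε : ε * ε = 1) (hP : ∀ (r : W) (hr : B r r = ε + ε), P (normTwoReflectionEquiv hB r ε hr hε))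
    (horbit : ∀ a b : W, B a a = ε + ε → B b b = ε + ε → ∃ g : B.IsometryEquiv B, P g ∧ g a = b) {φ : B.IsometryEquiv B}
    (hφ : IsWordIn {χ : B.IsometryEquiv B | ∃ s ∈ {ψ : B.IsometryEquiv B | ∃ (r : W) (hr : B r r = ε + ε),
        ψ = normTwoReflectionEquiv hB r ε hr hε}, ∃ t ∈ {ψ : B.IsometryEquiv B | ∃ (r : W) (hr : B r r = ε + ε),
        ψ = normTwoReflectionEquiv hB r ε hr hε}, χ = s.trans t} φ) :
    IsWordIn {ψ : B.IsometryEquiv B | ∃ α β : B.IsometryEquiv B, P α ∧ P β ∧ ψ = ((β.symm.trans α.symm).trans β).trans α} φ := by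
  refine hφ.bind fun χ hχ ↦ ?_
  obtain ⟨s, ⟨a, ha, rfl⟩, t, ⟨b, hb, rfl⟩, rfl⟩ := hχ
  obtain ⟨g, hg, hgab⟩ := horbit a b ha hb
  subst hgab
  exact isWordIn_commutators_normTwoReflectionEquiv_trans_map_of hB ha hε g hb hg (hP a ha)

/-- Conversely, **commutator words have determinant `1`** (for any class `P`). [cite: GritsenkoHulekSankaran2009, Cor. 1.8 ("det" is a character)] -/
theorem IsWordIn.det_eq_one_of_commutators_of {V : Type*} [AddCommGroup V] [Module.Finite ℤ V] [Module.Free ℤ V]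
    {Q : BilinForm ℤ V} {P : Q.IsometryEquiv Q → Prop} {φ : Q.IsometryEquiv Q}
    (hφ : IsWordIn {ψ : Q.IsometryEquiv Q | ∃ α β : Q.IsometryEquiv Q, P α ∧ P β ∧ ψ = ((β.symm.trans α.symm).trans β).trans α} φ) :
    LinearMap.det (φ : V →ₗ[ℤ] V) = 1 :=
  hφ.det_eq_one fun _ ⟨α, β, _, _, h⟩ ↦ h ▸ IsometryEquiv.det_commutator α β

end Identity

section Determinant

variable {W : Type*} [AddCommGroup W] [Module.Finite ℤ W] [Module.Free ℤ W] {B : BilinForm ℤ W}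

/-- **Theorem 1.3 with ONE orbit, words of determinant one**: under the one-orbit hypothesis, a word in the `(2ε)`-reflections of
determinant `1` (equivalently, of even length) is a word in commutators `[α, β]`, `α, β ∈ P` — "the square of such a class […]
belongs to the commutator", i.e. `⟨σ_a⟩ ∩ SO ⊆ [P, P]`. [cite: GritsenkoHulekSankaran2009, Thm. 1.3 (proof)] -/
theorem isWordIn_commutators_of_isWordIn_reflections_of_det_eq_one_of_forall_exists {P : B.IsometryEquiv B → Prop}
    (hB : B.IsSymm) {ε : ℤ} (hε : ε * ε = 1) (hP : ∀ (r : W) (hr : B r r = ε + ε), P (normTwoReflectionEquiv hB r ε hr hε))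
    (horbit : ∀ a b : W, B a a = ε + ε → B b b = ε + ε → ∃ g : B.IsometryEquiv B, P g ∧ g a = b) {φ : B.IsometryEquiv B}
    (hφ : IsWordIn {ψ : B.IsometryEquiv B | ∃ (r : W) (hr : B r r = ε + ε), ψ = normTwoReflectionEquiv hB r ε hr hε} φ)
    (hdet : LinearMap.det (φ : W →ₗ[ℤ] W) = 1) :
    IsWordIn {ψ : B.IsometryEquiv B | ∃ α β : B.IsometryEquiv B, P α ∧ P β ∧ ψ = ((β.symm.trans α.symm).trans β).trans α} φ := by
  obtain ⟨hS, hSdet⟩ := reflections_symm_mem_and_det hB hε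
  exact isWordIn_commutators_of_isWordIn_reflectionPairs_of_forall_exists hB hε hP horbit (hφ.pairs_of_det_eq_one hS hSdet hdet)

/-- **Theorem 1.3 with ONE orbit: "`⟨σ_a⟩^{ab}` has order dividing `2`"** — for a word `φ` in the `(2ε)`-reflections, `φ` is a
word in commutators of `P` iff `det φ = 1`: the classes of `⟨σ_a : a² = 2ε⟩` modulo `[P, P]`-words are cut out by `det`.
[cite: GritsenkoHulekSankaran2009, Thm. 1.3 ("Its order divides 2^N", here N = 1)] -/
theorem isWordIn_commutators_iff_det_eq_one_of_isWordIn_reflections_of_forall_exists {P : B.IsometryEquiv B → Prop}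
    (hB : B.IsSymm) {ε : ℤ} (hε : ε * ε = 1) (hP : ∀ (r : W) (hr : B r r = ε + ε), P (normTwoReflectionEquiv hB r ε hr hε))
    (horbit : ∀ a b : W, B a a = ε + ε → B b b = ε + ε → ∃ g : B.IsometryEquiv B, P g ∧ g a = b) {φ : B.IsometryEquiv B}
    (hφ : IsWordIn {ψ : B.IsometryEquiv B | ∃ (r : W) (hr : B r r = ε + ε), ψ = normTwoReflectionEquiv hB r ε hr hε} φ) :
    IsWordIn {ψ : B.IsometryEquiv B | ∃ α β : B.IsometryEquiv B, P α ∧ P β ∧ ψ = ((β.symm.trans α.symm).trans β).trans α} φ ↔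
      LinearMap.det (φ : W →ₗ[ℤ] W) = 1 :=
  ⟨fun h ↦ h.det_eq_one_of_commutators_of,
    isWordIn_commutators_of_isWordIn_reflections_of_det_eq_one_of_forall_exists hB hε hP horbit hφ⟩

/-- **Theorem 1.3 with ONE orbit, two words compared**: words `φ`, `ρ` in the `(2ε)`-reflections differ by a `[P, P]`-word iff
`det φ = det ρ` (so `⟨σ_a⟩/([P,P]-words)` has at most the two classes `det = ±1`).
[cite: GritsenkoHulekSankaran2009, Thm. 1.3 ("Its order divides 2^N", here N = 1)] -/
theorem isWordIn_commutators_trans_symm_iff_det_eq_of_isWordIn_reflections_of_forall_exists {P : B.IsometryEquiv B → Prop}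
    (hB : B.IsSymm) {ε : ℤ} (hε : ε * ε = 1) (hP : ∀ (r : W) (hr : B r r = ε + ε), P (normTwoReflectionEquiv hB r ε hr hε))
    (horbit : ∀ a b : W, B a a = ε + ε → B b b = ε + ε → ∃ g : B.IsometryEquiv B, P g ∧ g a = b) {φ ρ : B.IsometryEquiv B}
    (hφ : IsWordIn {ψ : B.IsometryEquiv B | ∃ (r : W) (hr : B r r = ε + ε), ψ = normTwoReflectionEquiv hB r ε hr hε} φ)
    (hρ : IsWordIn {ψ : B.IsometryEquiv B | ∃ (r : W) (hr : B r r = ε + ε), ψ = normTwoReflectionEquiv hB r ε hr hε} ρ) :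
    IsWordIn {ψ : B.IsometryEquiv B | ∃ α β : B.IsometryEquiv B, P α ∧ P β ∧ ψ = ((β.symm.trans α.symm).trans β).trans α}
        (φ.trans ρ.symm) ↔ LinearMap.det (φ : W →ₗ[ℤ] W) = LinearMap.det (ρ : W →ₗ[ℤ] W) := by
  rw [isWordIn_commutators_iff_det_eq_one_of_isWordIn_reflections_of_forall_exists hB hε hP horbit (hφ.trans hρ.symm),
    IsometryEquiv.det_trans_eq_mul, IsometryEquiv.det_symm_eq]
  rcases LinearMap.BilinForm.IsometryEquiv.det_eq_one_or_eq_neg_one φ with h | h <;>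
    rcases LinearMap.BilinForm.IsometryEquiv.det_eq_one_or_eq_neg_one ρ with h' | h' <;> simp [h, h']

end Determinant

/-! ### §2 Proposition 1.6 by its printed proof: every symmetric even unimodular lattice with `n± ≥ 2` -/

section Unimodular

variable {V : Type u} [AddCommGroup V] [Module.Finite ℤ V] [Module.Free ℤ V] (Q : BilinForm ℤ V)

/-- **Prop. 1.6, printed proof: "there exists `g ∈ SO⁺(L)` such that `g(a) = b`. But then `σ_aσ_b = σ_aσ_{g(a)} = σ_a g σ_a g⁻¹`
is a commutator"** — for every symmetric even unimodular lattice with `n₊ ≥ 2` and `n₋ ≥ 2` (`L = 2U ⊕ L₁` unimodular) and all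
`(−2)`-vectors `a, b`, the product `σ_aσ_b` is a word in commutators `[α, β]` with `α, β ∈ O⁺(L)` (the `(−2)`-vectors form one
`O⁺(L)`-orbit, GHS 2008 Prop. 2.4 (i), and `σ_a ∈ O⁺(L)`).
[cite: GritsenkoHulekSankaran2009, Prop. 1.6 (proof)] [cite: GritsenkoHulekSankaran2008Proportionality, Prop. 2.4 (i)] -/
theorem isWordIn_commutators_isOrientationPreserving_reflection_trans_reflection_of_isUnimodular (hs : Q.IsSymm)
    (hu : Q.IsUnimodular) (he : Q.IsEven) (h2 : 2 ≤ sigPos Q.toQuadraticMap) (h2' : 2 ≤ sigNeg Q.toQuadraticMap) {a b : V}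
    (ha : Q a a = -1 + -1) (hb : Q b b = -1 + -1) :
    IsWordIn {ψ : Q.IsometryEquiv Q | ∃ α β : Q.IsometryEquiv Q, α.IsOrientationPreserving ∧ β.IsOrientationPreserving ∧
        ψ = ((β.symm.trans α.symm).trans β).trans α}
      ((normTwoReflectionEquiv hs a (-1) ha (by norm_num)).trans (normTwoReflectionEquiv hs b (-1) hb (by norm_num))) := by
  obtain ⟨g, hg, hgab⟩ := exists_isometryEquiv_isOrientationPreserving_apply_eq_of_apply_self_eq_neg_two Q hs hu he h2 h2'
    (r := a) (s := b) (by rw [ha]; norm_num) (by rw [hb]; norm_num)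
  subst hgab
  exact isWordIn_commutators_normTwoReflectionEquiv_trans_map_of (P := fun α : Q.IsometryEquiv Q ↦ α.IsOrientationPreserving)
    hs ha (by norm_num) g hb hg ((isOrientationPreserving_normTwoReflectionEquiv_iff _ hs hu.nondegenerate a (-1) ha _).2 rfl)

/-- **Prop. 1.6, printed proof, for words: `⟨σ_aσ_b : a² = b² = −2⟩ ⊆ [O⁺(L), O⁺(L)]`** for every symmetric even unimodular
lattice with `n± ≥ 2`: every word in products of two `(−2)`-reflections is a word in commutators of `O⁺(L)`.
[cite: GritsenkoHulekSankaran2009, Prop. 1.6 (proof) and Thm. 1.3 (proof)] [cite: GritsenkoHulekSankaran2008Proportionality, Prop. 2.4 (i)] -/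
theorem isWordIn_commutators_isOrientationPreserving_of_isWordIn_negTwoReflectionPairs_of_isUnimodular (hs : Q.IsSymm)
    (hu : Q.IsUnimodular) (he : Q.IsEven) (h2 : 2 ≤ sigPos Q.toQuadraticMap) (h2' : 2 ≤ sigNeg Q.toQuadraticMap)
    {φ : Q.IsometryEquiv Q}
    (hφ : IsWordIn {χ : Q.IsometryEquiv Q | ∃ s ∈ {ψ : Q.IsometryEquiv Q | ∃ (r : V) (hr : Q r r = -1 + -1),
        ψ = normTwoReflectionEquiv hs r (-1) hr (by norm_num)}, ∃ t ∈ {ψ : Q.IsometryEquiv Q | ∃ (r : V) (hr : Q r r = -1 + -1),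
        ψ = normTwoReflectionEquiv hs r (-1) hr (by norm_num)}, χ = s.trans t} φ) :
    IsWordIn {ψ : Q.IsometryEquiv Q | ∃ α β : Q.IsometryEquiv Q, α.IsOrientationPreserving ∧ β.IsOrientationPreserving ∧
        ψ = ((β.symm.trans α.symm).trans β).trans α} φ := by
  have hP : ∀ (r : V) (hr : Q r r = -1 + -1), (normTwoReflectionEquiv hs r (-1) hr (by norm_num)).IsOrientationPreserving :=
    fun r hr ↦ (isOrientationPreserving_normTwoReflectionEquiv_iff _ hs hu.nondegenerate r (-1) hr _).2 rfl
  have horbit : ∀ a b : V, Q a a = -1 + -1 → Q b b = -1 + -1 →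
      ∃ g : Q.IsometryEquiv Q, g.IsOrientationPreserving ∧ g a = b := fun a b ha hb ↦
    exists_isometryEquiv_isOrientationPreserving_apply_eq_of_apply_self_eq_neg_two Q hs hu he h2 h2' (by rw [ha]; norm_num)
      (by rw [hb]; norm_num)
  exact isWordIn_commutators_of_isWordIn_reflectionPairs_of_forall_exists
    (P := fun α : Q.IsometryEquiv Q ↦ α.IsOrientationPreserving) hs (ε := -1) (by norm_num) hP horbit hφ

/-- **Thm. 1.3 (`N = 1`) with Prop. 2.4 (i): `⟨σ_a : a² = −2⟩ ∩ SO(L) ⊆ [O⁺(L), O⁺(L)]` and "`⟨σ_a⟩^{ab}` has order dividing 2"**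
for every symmetric even unimodular lattice with `n± ≥ 2`: a word in the `(−2)`-reflections is a word in commutators of
`O⁺(L)` iff its determinant is `1`. (With Kneser's `O⁺(L) = ⟨σ_a⟩` — in the tree for `L ≅ U^{⊕n}`, `n ≥ 3` — this is
`Õ⁺(L)^{ab} ≅ ℤ/2ℤ`, Prop. 1.6.) [cite: GritsenkoHulekSankaran2009, Thm. 1.3 and Prop. 1.6] [cite: GritsenkoHulekSankaran2008Proportionality, Prop. 2.4 (i)] -/
theorem isWordIn_commutators_isOrientationPreserving_iff_det_eq_one_of_isWordIn_negTwoReflections_of_isUnimodular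
    (hs : Q.IsSymm) (hu : Q.IsUnimodular) (he : Q.IsEven) (h2 : 2 ≤ sigPos Q.toQuadraticMap)
    (h2' : 2 ≤ sigNeg Q.toQuadraticMap) {φ : Q.IsometryEquiv Q}
    (hφ : IsWordIn {ψ : Q.IsometryEquiv Q | ∃ (r : V) (hr : Q r r = -1 + -1), ψ = normTwoReflectionEquiv hs r (-1) hr (by norm_num)} φ) :
    IsWordIn {ψ : Q.IsometryEquiv Q | ∃ α β : Q.IsometryEquiv Q, α.IsOrientationPreserving ∧ β.IsOrientationPreserving ∧
        ψ = ((β.symm.trans α.symm).trans β).trans α} φ ↔ LinearMap.det (φ : V →ₗ[ℤ] V) = 1 := by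
  have hP : ∀ (r : V) (hr : Q r r = -1 + -1), (normTwoReflectionEquiv hs r (-1) hr (by norm_num)).IsOrientationPreserving :=
    fun r hr ↦ (isOrientationPreserving_normTwoReflectionEquiv_iff _ hs hu.nondegenerate r (-1) hr _).2 rfl
  have horbit : ∀ a b : V, Q a a = -1 + -1 → Q b b = -1 + -1 →
      ∃ g : Q.IsometryEquiv Q, g.IsOrientationPreserving ∧ g a = b := fun a b ha hb ↦
    exists_isometryEquiv_isOrientationPreserving_apply_eq_of_apply_self_eq_neg_two Q hs hu he h2 h2' (by rw [ha]; norm_num)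
      (by rw [hb]; norm_num)
  exact isWordIn_commutators_iff_det_eq_one_of_isWordIn_reflections_of_forall_exists
    (P := fun α : Q.IsometryEquiv Q ↦ α.IsOrientationPreserving) hs (ε := -1) (by norm_num) hP horbit hφ

/-- **Thm. 1.3 (`N = 1`), two words compared**, for every symmetric even unimodular lattice with `n± ≥ 2`: two words in the
`(−2)`-reflections differ by a word in commutators of `O⁺(L)` iff their determinants agree.
[cite: GritsenkoHulekSankaran2009, Thm. 1.3 and Prop. 1.6] [cite: GritsenkoHulekSankaran2008Proportionality, Prop. 2.4 (i)] -/
theorem isWordIn_commutators_isOrientationPreserving_trans_symm_iff_of_isWordIn_negTwoReflections_of_isUnimodular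
    (hs : Q.IsSymm) (hu : Q.IsUnimodular) (he : Q.IsEven) (h2 : 2 ≤ sigPos Q.toQuadraticMap)
    (h2' : 2 ≤ sigNeg Q.toQuadraticMap) {φ ρ : Q.IsometryEquiv Q}
    (hφ : IsWordIn {ψ : Q.IsometryEquiv Q | ∃ (r : V) (hr : Q r r = -1 + -1), ψ = normTwoReflectionEquiv hs r (-1) hr (by norm_num)} φ)
    (hρ : IsWordIn {ψ : Q.IsometryEquiv Q | ∃ (r : V) (hr : Q r r = -1 + -1), ψ = normTwoReflectionEquiv hs r (-1) hr (by norm_num)} ρ) :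
    IsWordIn {ψ : Q.IsometryEquiv Q | ∃ α β : Q.IsometryEquiv Q, α.IsOrientationPreserving ∧ β.IsOrientationPreserving ∧
        ψ = ((β.symm.trans α.symm).trans β).trans α} (φ.trans ρ.symm) ↔
      LinearMap.det (φ : V →ₗ[ℤ] V) = LinearMap.det (ρ : V →ₗ[ℤ] V) := by
  have hP : ∀ (r : V) (hr : Q r r = -1 + -1), (normTwoReflectionEquiv hs r (-1) hr (by norm_num)).IsOrientationPreserving :=
    fun r hr ↦ (isOrientationPreserving_normTwoReflectionEquiv_iff _ hs hu.nondegenerate r (-1) hr _).2 rfl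
  have horbit : ∀ a b : V, Q a a = -1 + -1 → Q b b = -1 + -1 →
      ∃ g : Q.IsometryEquiv Q, g.IsOrientationPreserving ∧ g a = b := fun a b ha hb ↦
    exists_isometryEquiv_isOrientationPreserving_apply_eq_of_apply_self_eq_neg_two Q hs hu he h2 h2' (by rw [ha]; norm_num)
      (by rw [hb]; norm_num)
  exact isWordIn_commutators_trans_symm_iff_det_eq_of_isWordIn_reflections_of_forall_exists
    (P := fun α : Q.IsometryEquiv Q ↦ α.IsOrientationPreserving) hs (ε := -1) (by norm_num) hP horbit hφ hρ

end Unimodular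

/-! ### §3 `U^{⊕n}`, `n ≥ 2` -/

section HyperbolicSum

/-- **Prop. 1.6's commutator for `U^{⊕n}`, `n ≥ 2`**: every product `σ_aσ_b` of two `(−2)`-reflections of `hyperbolicSum n` is a
word in commutators of `O⁺(U^{⊕n})` (row g50-#2 gave `⟨σ_aσ_b⟩ = SO⁺ = [O⁺, O⁺]` for `n ≥ 3` by Eichler words; the printed
one-orbit argument also covers `n = 2`). [cite: GritsenkoHulekSankaran2009, Prop. 1.6 (proof)] [cite: GritsenkoHulekSankaran2008Proportionality, Prop. 2.4 (i)] -/
theorem hyperbolicSum_isWordIn_commutators_isOrientationPreserving_reflection_trans_reflection {n : ℕ} (hn : 2 ≤ n)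
    {a b : (Fin n → ℤ) × (Fin n → ℤ)} (ha : hyperbolicSum n a a = -1 + -1) (hb : hyperbolicSum n b b = -1 + -1) :
    IsWordIn {ψ : (hyperbolicSum n).IsometryEquiv (hyperbolicSum n) | ∃ α β : (hyperbolicSum n).IsometryEquiv (hyperbolicSum n),
        α.IsOrientationPreserving ∧ β.IsOrientationPreserving ∧ ψ = ((β.symm.trans α.symm).trans β).trans α}
      ((normTwoReflectionEquiv (isSymm_hyperbolicSum n) a (-1) ha (by norm_num)).trans
        (normTwoReflectionEquiv (isSymm_hyperbolicSum n) b (-1) hb (by norm_num))) := by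
  obtain ⟨hp, hm⟩ := sigPos_sigNeg_hyperbolicSum n
  exact isWordIn_commutators_isOrientationPreserving_reflection_trans_reflection_of_isUnimodular _ (isSymm_hyperbolicSum n)
    (isUnimodular_hyperbolicSum n) (isEven_hyperbolicSum n) (by omega) (by omega) ha hb

/-- **Thm. 1.3 (`N = 1`) for `U^{⊕n}`, `n ≥ 2`**: a word in the `(−2)`-reflections of `hyperbolicSum n` is a word in commutators
of `O⁺(U^{⊕n})` iff its determinant is `1`. [cite: GritsenkoHulekSankaran2009, Thm. 1.3 and Prop. 1.6] [cite: GritsenkoHulekSankaran2008Proportionality, Prop. 2.4 (i)] -/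
theorem hyperbolicSum_isWordIn_commutators_isOrientationPreserving_iff_det_eq_one_of_isWordIn_negTwoReflections {n : ℕ}
    (hn : 2 ≤ n) {φ : (hyperbolicSum n).IsometryEquiv (hyperbolicSum n)}
    (hφ : IsWordIn {ψ : (hyperbolicSum n).IsometryEquiv (hyperbolicSum n) | ∃ (r : (Fin n → ℤ) × (Fin n → ℤ))
        (hr : hyperbolicSum n r r = -1 + -1), ψ = normTwoReflectionEquiv (isSymm_hyperbolicSum n) r (-1) hr (by norm_num)} φ) :
    IsWordIn {ψ : (hyperbolicSum n).IsometryEquiv (hyperbolicSum n) | ∃ α β : (hyperbolicSum n).IsometryEquiv (hyperbolicSum n),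
        α.IsOrientationPreserving ∧ β.IsOrientationPreserving ∧ ψ = ((β.symm.trans α.symm).trans β).trans α} φ ↔
      LinearMap.det (φ : (Fin n → ℤ) × (Fin n → ℤ) →ₗ[ℤ] (Fin n → ℤ) × (Fin n → ℤ)) = 1 := by
  obtain ⟨hp, hm⟩ := sigPos_sigNeg_hyperbolicSum n
  exact isWordIn_commutators_isOrientationPreserving_iff_det_eq_one_of_isWordIn_negTwoReflections_of_isUnimodular _
    (isSymm_hyperbolicSum n) (isUnimodular_hyperbolicSum n) (isEven_hyperbolicSum n) (by omega) (by omega) hφ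

end HyperbolicSum

end Literature.Topology.FourManifolds

end
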